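import Literature.Analysis.FluidPDE.ClassicalSuitable
import Literature.Analysis.FluidPDE.PressurePoisson
import Literature.Analysis.FluidPDE.MildSolutionProofs
import Literature.Analysis.FluidPDE.TaoEnstrophyLocalisationProofs
import Mathlib.Analysis.ODE.Gronwall
import HarnessLib

/-!
# The energy inequality for the difference of two classical solutions (the remainder equation)

Analysis/FluidPDE proofs file (theorems only) on the discharge path of the corrected form of
`Literature.Analysis.FluidPDE.albritton_singular_point_of_blowup` (Albritton 2018, Cor. 4.6 over
Albritton's class; `AlbrittonSingularPointKatoClass.lean`). In the proof of Prop. 4.5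
(arXiv:1612.04439, p. 23, (4.32)–(4.33)): "The remainder `U [= u − V]` solves the perturbed
Navier–Stokes equations `∂ₜU − ΔU + div U ⊗ U + div U ⊗ V + div V ⊗ U = −∇P`, `div U = 0` …
By the well-posedness theory for the equation as well as the energy inequality, one may prove
that `U` is in the energy space up to the blow-up time: `U ∈ L^∞_t L²_x ∩ L²_t Ḣ¹_x(Q_{T*})`."
This file proves the **energy inequality** half, for classical solutions: if `(v, π_v)` and
`(V, π_V)` solve the unforced unit-viscosity system classically on an open time interval, `v` and
`V` are bounded, the difference `W = v − V` has square-integrable slices (a priori, e.g. by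
`OseenMildDifferenceL2.lean`) and the pressure difference is `L²` up to a constant on every slice,
then for `t₀ ≤ t` in the interval

  `‖W(t)‖₂² ≤ ‖W(t₀)‖₂² e^{M²(t − t₀)}`,  `M = sup |V|`,

and `∫_{t₀}^{t} ∫ |∇W|² ≤ ‖W(t₀)‖₂² (1 + M²(t − t₀)) e^{M²(t − t₀)}` — bounds in which only the
bound of the *long-lived* factor `V` enters, not that of `v` (this is what makes them uniform up
to the blow-up time of `v`).

## Proof (Leray's energy method with cut-offs)

* §1 The remainder equation: `W = v − V`, `P = π_v − π_V` satisfy pointwise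
  `∂ₜW + (W·∇)W = ΔW − ∇P + f`, `f = −(V·∇)W − (W·∇)V`, `div W = 0`.
* §2 The slice inequality: pairing with `χ W`, `χ = cutoff R` (the tree's local energy balance
  `integral_mul_inner_dt_of_momentum`), and integrating the `f`-terms by parts
  (`integral_inner_convect_add_eq_zero`: `∫ χ ⟪(V·∇)W, W⟫ = −½∫ (Dχ·V)|W|²`,
  `∫ χ ⟪(W·∇)V, W⟫ = −∫ χ ⟪V, (W·∇)W⟫ − ∫ (Dχ·W)⟪V, W⟫`), Young's inequality
  `M|W||∇W| ≤ ½|∇W|² + ½M²|W|²` and the constant-free pressure `∫ c Dχ·W = 0` give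
  `2∫ χ ⟪∂ₜW, W⟫ + ∫ χ |∇W|² ≤ M² ∫ χ |W|² + ε_R`, `ε_R = O(R⁻¹)` in terms of the bounds.
* §3 Time: `E_R(t) = ∫ χ_R |W(t)|²` is differentiable with `E_R' = 2∫ χ ⟪∂ₜW, W⟫`
  (`hasDerivAt_integral_of_support_subset`), so Grönwall (Mathlib
  `le_gronwallBound_of_liminf_deriv_right_le`) bounds `E_R`, and the fundamental theorem of
  calculus bounds `∫_{t₀}^{t} ∫ χ_R |∇W|²`.
* §4 `R → ∞`: dominated convergence for `E_R`, Fatou for the dissipation.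

## Mathlib / tree search

Tree (reused): `integral_mul_inner_dt_of_momentum` (`ClassicalSuitable`);
`integral_inner_convect_add_eq_zero`, `integral_mul_divergence_add_eq_zero_left`,
`convect_smul_apply`, `cutoff`, `exists_norm_fderiv_cutoff_le`, `tendsto_cutoff_natCast_add_one`
(`WholeSpaceIBP`); `exists_abs_laplacian_cutoff_le` (`MildSolutionProofs`);
`sq_opNorm_le_frobeniusNormSq` (`TaoEnstrophyLocalisationProofs`); `IsClassicalNSSolutionOn`,
`IsSmoothSpaceTimeOn` calculus (`ClassicalSolutionCalculus`, `SpaceTimeCalculus`: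
`hasDerivAt_integral_of_support_subset`, `continuousOn_integral_of_support_subset`,
`timeDerivWithin_eq_deriv_of_mem_nhds`). Mathlib: `le_gronwallBound_of_liminf_deriv_right_le`,
`HasDerivWithinAt.liminf_right_slope_le`, `gronwallBound`, `ContDiffAt.laplacian_sub`,
`intervalIntegral.integral_eq_sub_of_hasDerivAt`, `tendsto_integral_of_dominated_convergence`,
`lintegral_liminf_le`. `lean search 'perturbed.*energy|remainder_energy|difference_energy'`: only
the caloric (`CaloricRemainderEnergyBound`) and local-Leray-difference programmes, neither for
two classical solutions.

## References

* D. Albritton, Anal. PDE 11 (2018) 1415–1456 = arXiv:1612.04439, proof of Prop. 4.5,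
  (4.32)–(4.33). [Albritton2018]
* J. Leray, Acta Math. 63 (1934), §17 (the energy method). [Leray1934]
* P. G. Lemarié-Rieusset, *The Navier–Stokes Problem in the 21st Century* (2016), Prop. 15.1
  (the same argument for `L³` data). [LemarieRieusset2016]
-/

noncomputable section

open MeasureTheory TopologicalSpace Set Function Filter Topology Metric InnerProductSpace
open scoped Laplacian RealInnerProductSpace ENNReal NNReal ContDiff

namespace Literature.Analysis.FluidPDE

namespace PerturbedEnergyInequality

variable {E : Type*} [NormedAddCommGroup E] [InnerProductSpace ℝ E] [FiniteDimensional ℝ E]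
  [MeasurableSpace E] [BorelSpace E]

/-! ### §1 The remainder equation -/

section Remainder

variable {S : Set ℝ} {v V : ℝ → E → E} {πv πV : ℝ → E → ℝ}

omit [FiniteDimensional ℝ E] [MeasurableSpace E] [BorelSpace E] in
/-- The convective algebra of the remainder: `(v·∇)v − (V·∇)V = (W·∇)W + (V·∇)W + (W·∇)V`,
`W = v − V`. [folklore] -/
theorem convect_sub_convect {a b : E → E} {x : E} (ha : DifferentiableAt ℝ a x)
    (hb : DifferentiableAt ℝ b x) :
    convect a a x - convect b b x =
      convect (fun y => a y - b y) (fun y => a y - b y) x + convect b (fun y => a y - b y) x +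
        convect (fun y => a y - b y) b x := by
  simp only [convect, fderiv_fun_sub ha hb, map_sub]
  simp only [FunLike.coe_sub, Pi.sub_apply]
  abel

omit [MeasurableSpace E] [BorelSpace E] in
/-- **The remainder equation.** If `(v, π_v)` and `(V, π_V)` solve the unforced unit-viscosity
Navier–Stokes system classically on `S`, then `W = v − V`, `P = π_v − π_V` satisfy, at every point
of `S × E`, `∂ₜW + (W·∇)W = ΔW − ∇P + f` with `f = −(V·∇)W − (W·∇)V`, and `div W = 0` (Albritton
2018, (4.32), written with `div(U ⊗ U + U ⊗ V + V ⊗ U) = (U·∇)U + (V·∇)U + (U·∇)V`). [cite: Albritton2018, Prop. 4.5 proof, (4.32)] -/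
theorem remainder_momentum (hv : IsClassicalNSSolutionOn S 1 0 v πv)
    (hV : IsClassicalNSSolutionOn S 1 0 V πV) {t : ℝ} (ht : t ∈ S) (x : E) :
    timeDerivWithin S (fun s y => v s y - V s y) t x +
        convect (fun y => v t y - V t y) (fun y => v t y - V t y) x =
      (1 : ℝ) • (Δ (fun y => v t y - V t y)) x - gradient (fun y => πv t y - πV t y) x +
        (-(convect (V t) (fun y => v t y - V t y) x + convect (fun y => v t y - V t y) (V t) x)) := by
  have hvs : ContDiff ℝ ∞ (v t) := hv.contDiff_velocity ht
  have hVs : ContDiff ℝ ∞ (V t) := hV.contDiff_velocity ht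
  have hpv : ContDiff ℝ ∞ (πv t) := hv.contDiff_pressure ht
  have hpV : ContDiff ℝ ∞ (πV t) := hV.contDiff_pressure ht
  have hmv := hv.momentum t ht x
  have hmV := hV.momentum t ht x
  simp only [Pi.zero_apply, add_zero] at hmv hmV
  -- time derivative of the difference
  have hdt : timeDerivWithin S (fun s y => v s y - V s y) t x =
      timeDerivWithin S v t x - timeDerivWithin S V t x := by
    simp only [timeDerivWithin_apply]
    exact derivWithin_fun_sub (hv.smooth_velocity.differentiableWithinAt_time ht x)
      (hV.smooth_velocity.differentiableWithinAt_time ht x)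
  -- Laplacian and gradient of the difference
  have hΔ : (Δ (fun y => v t y - V t y)) x = (Δ (v t)) x - (Δ (V t)) x := by
    have hv2 : ContDiff ℝ 2 (v t) := contDiff_infty.1 hvs 2
    have hV2 : ContDiff ℝ 2 (V t) := contDiff_infty.1 hVs 2
    exact (hv2.contDiffAt (x := x)).laplacian_sub (hV2.contDiffAt (x := x))
  have hgr : gradient (fun y => πv t y - πV t y) x = gradient (πv t) x - gradient (πV t) x := by
    simp only [gradient]
    rw [fderiv_fun_sub ((hpv.differentiable (by simp)) x) ((hpV.differentiable (by simp)) x), map_sub]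
  have hconv := convect_sub_convect ((hvs.differentiable (by simp)) x) ((hVs.differentiable (by simp)) x)
  rw [hdt, hΔ, hgr, one_smul]
  rw [one_smul] at hmv hmV
  -- assemble: `dtv − dtV + [(v·∇)v − (V·∇)V − (V·∇)W − (W·∇)V] = Δv − ΔV − (∇πv − ∇πV)`
  have e1 : timeDerivWithin S v t x = (Δ (v t)) x - gradient (πv t) x - convect (v t) (v t) x := by
    rw [← hmv]; abel
  have e2 : timeDerivWithin S V t x = (Δ (V t)) x - gradient (πV t) x - convect (V t) (V t) x := by
    rw [← hmV]; abel
  rw [e1, e2]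
  -- `convect v v = convect V V + (convect W W + convect V W + convect W V)`
  have e4 : convect (v t) (v t) x = convect (V t) (V t) x +
      (convect (fun y => v t y - V t y) (fun y => v t y - V t y) x +
        convect (V t) (fun y => v t y - V t y) x + convect (fun y => v t y - V t y) (V t) x) := by
    rw [← hconv]; abel
  rw [e4]
  abel

end Remainder

/-! ### §2 The slice inequality -/

section Slice

variable {u V dtu : E → E} {P : E → ℝ}

omit [MeasurableSpace E] [BorelSpace E] in
/-- Young's inequality for the stretching term: `|⟪V, (u·∇)u⟫| ≤ ½|∇u|²_F + ½M²|u|²` when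
`|V| ≤ M` (`‖Du(x) w‖ ≤ √|Du(x)|²_F ‖w‖`). [folklore] -/
theorem abs_inner_convect_le {M : ℝ} (hM : 0 ≤ M) {x : E} (hV : ‖V x‖ ≤ M) (hu : DifferentiableAt ℝ u x) :
    |⟪V x, convect u u x⟫| ≤ 2⁻¹ * frobeniusNormSq (fderiv ℝ u x) + 2⁻¹ * M ^ 2 * ‖u x‖ ^ 2 := by
  have _ := hu
  set F : ℝ := frobeniusNormSq (fderiv ℝ u x) with hF
  have hF0 : 0 ≤ F := frobeniusNormSq_nonneg _
  have hop : ‖fderiv ℝ u x‖ ≤ Real.sqrt F :=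
    Real.le_sqrt_of_sq_le (sq_opNorm_le_frobeniusNormSq (fderiv ℝ u x))
  have h1 : |⟪V x, convect u u x⟫| ≤ M * (Real.sqrt F * ‖u x‖) := by
    calc |⟪V x, convect u u x⟫| ≤ ‖V x‖ * ‖convect u u x‖ := abs_real_inner_le_norm _ _
      _ ≤ M * (‖fderiv ℝ u x‖ * ‖u x‖) := by
          refine mul_le_mul hV (ContinuousLinearMap.le_opNorm _ _) (norm_nonneg _) hM
      _ ≤ M * (Real.sqrt F * ‖u x‖) := by gcongr
  have h2 : M * (Real.sqrt F * ‖u x‖) ≤ 2⁻¹ * F + 2⁻¹ * M ^ 2 * ‖u x‖ ^ 2 := by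
    have hsq : Real.sqrt F ^ 2 = F := Real.sq_sqrt hF0
    nlinarith [sq_nonneg (Real.sqrt F - M * ‖u x‖), Real.sqrt_nonneg F, norm_nonneg (u x)]
  exact h1.trans h2

/-- **The slice inequality for the remainder.** Let `u ∈ C²(E; E)` be divergence free, `P ∈ C¹`,
`dtu` continuous, `V ∈ C¹` divergence free with `|V| ≤ M`, and suppose
`dtu + (u·∇)u = Δu − ∇P + f`, `f = −(V·∇)u − (u·∇)V`, pointwise. Then for every `χ ∈ C²_c(E)` with
`0 ≤ χ`, `‖Dχ‖ ≤ δ₁`, `|Δχ| ≤ δ₂`, every constant `c`, and all `Mu ≥ sup|u|`: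
`2∫ χ⟪dtu, u⟫ + ∫ χ|∇u|²_F ≤ M² ∫ χ|u|² + δ₁(Mu + 3M)∫|u|² + δ₂∫|u|² + 2δ₁(∫|P − c|² + ∫|u|²)`
(Leray's energy method at a fixed time: the local energy balance
`integral_mul_inner_dt_of_momentum`, the two integrations by parts of the `f`-terms, Young's
inequality, and `∫ c Dχ·u = −c∫ χ div u = 0`). [cite: Leray1934, §17; Albritton2018, Prop. 4.5 proof, (4.32)–(4.33)] -/
theorem slice_inequality (hu : ContDiff ℝ 2 u) (hP : ContDiff ℝ 1 P) (hdt : Continuous dtu)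
    (hV : ContDiff ℝ 1 V) (hdivu : VectorCalculus.IsDivFree u) (hdivV : VectorCalculus.IsDivFree V)
    {M Mu : ℝ} (hM : 0 ≤ M) (hVM : ∀ x, ‖V x‖ ≤ M) (huM : ∀ x, ‖u x‖ ≤ Mu)
    (hmom : ∀ x, dtu x + convect u u x = (1 : ℝ) • (Δ u) x - gradient P x +
      (-(convect V u x + convect u V x)))
    (hu2 : Integrable (fun x => ‖u x‖ ^ 2) volume)
    {c : ℝ} (hPc : Integrable (fun x => (P x - c) ^ 2) volume)
    {χ : E → ℝ} (hχ : ContDiff ℝ 2 χ) (hχc : HasCompactSupport χ) (hχ0 : ∀ x, 0 ≤ χ x)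
    {δ₁ δ₂ : ℝ} (hδ₁ : 0 ≤ δ₁)
    (hDχ : ∀ x, ‖fderiv ℝ χ x‖ ≤ δ₁) (hΔχ : ∀ x, |(Δ χ) x| ≤ δ₂) :
    2 * (∫ x, χ x * ⟪dtu x, u x⟫) + ∫ x, χ x * frobeniusNormSq (fderiv ℝ u x) ≤
      M ^ 2 * (∫ x, χ x * ‖u x‖ ^ 2) +
        (δ₁ * (Mu + 3 * M) + δ₂) * (∫ x, ‖u x‖ ^ 2) +
        2 * δ₁ * ((∫ x, (P x - c) ^ 2) + ∫ x, ‖u x‖ ^ 2) := by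
  have hu1 : ContDiff ℝ 1 u := hu.of_le one_le_two
  have hχ1' : ContDiff ℝ 1 χ := hχ.of_le one_le_two
  have huc : Continuous u := hu1.continuous
  have hVc : Continuous V := hV.continuous
  have hχcont : Continuous χ := hχ1'.continuous
  have hDχc : Continuous (fderiv ℝ χ) := hχ1'.continuous_fderiv one_ne_zero
  have hDuc : Continuous (fderiv ℝ u) := hu1.continuous_fderiv one_ne_zero
  have hcDχ : HasCompactSupport (fderiv ℝ χ) := hχc.fderiv (𝕜 := ℝ)
  -- the source `f`
  set f : E → E := fun x => -(convect V u x + convect u V x) with hf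
  have hfc : Continuous f := (((hDuc.clm_apply hVc)).add ((hV.continuous_fderiv one_ne_zero).clm_apply huc)).neg
  have hmom' : ∀ x, dtu x + convect u u x = (1 : ℝ) • (Δ u) x - gradient P x + f x := hmom
  -- the local energy balance of the tree, `ν = 1`
  have h0 := integral_mul_inner_dt_of_momentum hu hP hdt hfc hmom' hdivu hχ hχc
  -- ### the two integrations by parts of the `f`-terms
  -- integrability helpers: continuous integrands against the compactly supported `χ` / `Dχ`
  have cs_χ : ∀ {g : E → ℝ}, Continuous g → Integrable (fun x => χ x * g x) (volume : Measure E) :=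
    fun hg => (hχcont.mul hg).integrable_of_hasCompactSupport hχc.mul_right
  have cs_Dχ : ∀ {g : E → ℝ} (w : E → E), Continuous g → Continuous w →
      Integrable (fun x => fderiv ℝ χ x (w x) * g x) (volume : Measure E) := fun w hg hw =>
    ((hDχc.clm_apply hw).mul hg).integrable_of_hasCompactSupport
      ((hcDχ.mono fun x hx => by contrapose! hx; simp_all).mul_right)
  -- (F₁) `∫ χ ⟪(V·∇)u, u⟫ = -½ ∫ (Dχ·V) |u|²`
  have hχu1 : ContDiff ℝ 1 fun x => χ x • u x := hχ1'.smul hu1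
  have hχuc : HasCompactSupport fun x => χ x • u x := hχc.smul_right
  have F₁ : ∫ x, χ x * ⟪convect V u x, u x⟫ = -(2⁻¹ * ∫ x, fderiv ℝ χ x (V x) * ‖u x‖ ^ 2) := by
    have h := integral_inner_convect_add_eq_zero hV hu1 hχu1 hχuc
    have hz : ∫ x, VectorCalculus.divergence V x * ⟪u x, χ x • u x⟫ = 0 := by
      simp [hdivV _]
    rw [hz, add_zero] at h
    have e1 : ∫ x, ⟪convect V u x, χ x • u x⟫ = ∫ x, χ x * ⟪convect V u x, u x⟫ :=
      integral_congr_ae (Eventually.of_forall fun x => by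
        show ⟪convect V u x, χ x • u x⟫ = χ x * ⟪convect V u x, u x⟫
        rw [real_inner_smul_right])
    have e2 : ∫ x, ⟪u x, convect V (fun y => χ y • u y) x⟫ =
        ∫ x, (χ x * ⟪convect V u x, u x⟫ + fderiv ℝ χ x (V x) * ‖u x‖ ^ 2) := by
      refine integral_congr_ae (Eventually.of_forall fun x => ?_)
      show ⟪u x, convect V (fun y => χ y • u y) x⟫ =
        χ x * ⟪convect V u x, u x⟫ + fderiv ℝ χ x (V x) * ‖u x‖ ^ 2
      rw [convect_smul_apply ((hχ1'.differentiable one_ne_zero) x) ((hu1.differentiable one_ne_zero) x),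
        inner_add_right, real_inner_smul_right, real_inner_smul_right, real_inner_self_eq_norm_sq,
        real_inner_comm]
    have i₁ : Integrable (fun x => χ x * ⟪convect V u x, u x⟫) volume :=
      cs_χ ((hDuc.clm_apply hVc).inner huc)
    have i₂ : Integrable (fun x => fderiv ℝ χ x (V x) * ‖u x‖ ^ 2) volume :=
      cs_Dχ _ (huc.norm.pow 2) hVc
    rw [e1, e2, integral_add i₁ i₂] at h
    linarith
  -- (F₂) `∫ χ ⟪(u·∇)V, u⟫ = -∫ χ ⟪V, (u·∇)u⟫ - ∫ (Dχ·u) ⟪V, u⟫`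
  have F₂ : ∫ x, χ x * ⟪convect u V x, u x⟫ =
      -(∫ x, χ x * ⟪V x, convect u u x⟫) - ∫ x, fderiv ℝ χ x (u x) * ⟪V x, u x⟫ := by
    have h := integral_inner_convect_add_eq_zero hu1 hV hχu1 hχuc
    have hz : ∫ x, VectorCalculus.divergence u x * ⟪V x, χ x • u x⟫ = 0 := by
      simp [hdivu _]
    rw [hz, add_zero] at h
    have e1 : ∫ x, ⟪convect u V x, χ x • u x⟫ = ∫ x, χ x * ⟪convect u V x, u x⟫ :=
      integral_congr_ae (Eventually.of_forall fun x => by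
        show ⟪convect u V x, χ x • u x⟫ = χ x * ⟪convect u V x, u x⟫
        rw [real_inner_smul_right])
    have e2 : ∫ x, ⟪V x, convect u (fun y => χ y • u y) x⟫ =
        ∫ x, (χ x * ⟪V x, convect u u x⟫ + fderiv ℝ χ x (u x) * ⟪V x, u x⟫) := by
      refine integral_congr_ae (Eventually.of_forall fun x => ?_)
      show ⟪V x, convect u (fun y => χ y • u y) x⟫ =
        χ x * ⟪V x, convect u u x⟫ + fderiv ℝ χ x (u x) * ⟪V x, u x⟫
      rw [convect_smul_apply ((hχ1'.differentiable one_ne_zero) x) ((hu1.differentiable one_ne_zero) x),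
        inner_add_right, real_inner_smul_right, real_inner_smul_right]
    have i₁ : Integrable (fun x => χ x * ⟪V x, convect u u x⟫) volume :=
      cs_χ (hVc.inner (hDuc.clm_apply huc))
    have i₂ : Integrable (fun x => fderiv ℝ χ x (u x) * ⟪V x, u x⟫) volume :=
      cs_Dχ _ (hVc.inner huc) huc
    rw [e1, e2, integral_add i₁ i₂] at h
    linarith
  -- the `f`-term of the balance
  have hF : ∫ x, χ x * ⟪f x, u x⟫ =
      2⁻¹ * (∫ x, fderiv ℝ χ x (V x) * ‖u x‖ ^ 2) + (∫ x, χ x * ⟪V x, convect u u x⟫) +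
        ∫ x, fderiv ℝ χ x (u x) * ⟪V x, u x⟫ := by
    have e : ∀ x, χ x * ⟪f x, u x⟫ = -(χ x * ⟪convect V u x, u x⟫) - χ x * ⟪convect u V x, u x⟫ := by
      intro x; simp only [hf, inner_neg_left, inner_add_left]; ring
    have i₁ : Integrable (fun x => -(χ x * ⟪convect V u x, u x⟫)) volume :=
      (cs_χ ((hDuc.clm_apply hVc).inner huc)).neg
    have i₂ : Integrable (fun x => χ x * ⟪convect u V x, u x⟫) volume :=
      cs_χ (((hV.continuous_fderiv one_ne_zero).clm_apply huc).inner huc)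
    rw [integral_congr_ae (Eventually.of_forall e), integral_sub i₁ i₂, integral_neg, F₁, F₂]
    ring
  -- ### the pressure term without its constant: `∫ P Dχ·u = ∫ (P - c) Dχ·u`
  have hPress : ∫ x, P x * fderiv ℝ χ x (u x) = ∫ x, (P x - c) * fderiv ℝ χ x (u x) := by
    have hdiv0 : ∫ x, fderiv ℝ χ x (u x) = 0 := by
      have h := integral_mul_divergence_add_eq_zero_left hχ1' hu1 hχc
      have hz : ∫ x, χ x * VectorCalculus.divergence u x = 0 := by simp [hdivu _]
      rw [hz, zero_add] at h
      rw [← h]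
      refine integral_congr_ae (Eventually.of_forall fun x => ?_)
      show fderiv ℝ χ x (u x) = ⟪u x, gradient χ x⟫
      rw [real_inner_comm, gradient, InnerProductSpace.toDual_symm_apply]
    have i1 : Integrable (fun x => P x * fderiv ℝ χ x (u x)) volume := by
      have := cs_Dχ _ hP.continuous huc
      exact this.congr (Eventually.of_forall fun x => mul_comm _ _)
    have i2 : Integrable (fun x => c * fderiv ℝ χ x (u x)) volume :=
      ((cs_Dχ _ continuous_const huc).congr (Eventually.of_forall fun x => mul_comm _ _))
    have e : ∀ x, (P x - c) * fderiv ℝ χ x (u x) = P x * fderiv ℝ χ x (u x) - c * fderiv ℝ χ x (u x) :=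
      fun x => by ring
    rw [integral_congr_ae (Eventually.of_forall e), integral_sub i1 i2, integral_const_mul, hdiv0,
      mul_zero, sub_zero]
  -- ### bounds on the error terms
  set e2 : ℝ := ∫ x, ‖u x‖ ^ 2 with he2
  have he20 : 0 ≤ e2 := integral_nonneg fun x => by positivity
  have hp2 : 0 ≤ ∫ x, (P x - c) ^ 2 := integral_nonneg fun x => by positivity
  -- (i) `|∫ (Dχ·u)|u|²| ≤ δ₁ Mu ∫|u|²`
  have b1 : |∫ x, fderiv ℝ χ x (u x) * ‖u x‖ ^ 2| ≤ δ₁ * Mu * e2 := by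
    rw [← Real.norm_eq_abs, he2, ← integral_const_mul]
    refine (norm_integral_le_integral_norm _).trans (integral_mono_of_nonneg
      (Eventually.of_forall fun x => norm_nonneg _) (hu2.const_mul _) (Eventually.of_forall fun x => ?_))
    dsimp only
    rw [norm_mul, Real.norm_eq_abs, Real.norm_eq_abs, abs_of_nonneg (sq_nonneg ‖u x‖)]
    calc |fderiv ℝ χ x (u x)| * ‖u x‖ ^ 2 ≤ (δ₁ * Mu) * ‖u x‖ ^ 2 := by
          refine mul_le_mul_of_nonneg_right ?_ (sq_nonneg _)
          rw [← Real.norm_eq_abs]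
          exact (ContinuousLinearMap.le_opNorm _ _).trans (mul_le_mul (hDχ x) (huM x) (norm_nonneg _) hδ₁)
      _ = δ₁ * Mu * ‖u x‖ ^ 2 := by ring
  -- (ii) `|∫ Δχ |u|²| ≤ δ₂ ∫|u|²`
  have b2 : |∫ x, (Δ χ) x * ‖u x‖ ^ 2| ≤ δ₂ * e2 := by
    rw [← Real.norm_eq_abs, he2, ← integral_const_mul]
    refine (norm_integral_le_integral_norm _).trans (integral_mono_of_nonneg
      (Eventually.of_forall fun x => norm_nonneg _) (hu2.const_mul _) (Eventually.of_forall fun x => ?_))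
    dsimp only
    rw [norm_mul, Real.norm_eq_abs, Real.norm_eq_abs, abs_of_nonneg (sq_nonneg ‖u x‖)]
    exact mul_le_mul_of_nonneg_right (hΔχ x) (sq_nonneg _)
  -- (iii) `|∫ (P - c) Dχ·u| ≤ δ₁ (∫ (P-c)² + ∫ |u|²) / 1` (AM–GM)
  have b3 : |∫ x, (P x - c) * fderiv ℝ χ x (u x)| ≤ δ₁ * ((∫ x, (P x - c) ^ 2) + e2) := by
    rw [← Real.norm_eq_abs, he2, ← integral_add hPc hu2, ← integral_const_mul]
    refine (norm_integral_le_integral_norm _).trans (integral_mono_of_nonneg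
      (Eventually.of_forall fun x => norm_nonneg _) ((hPc.add hu2).const_mul _)
      (Eventually.of_forall fun x => ?_))
    dsimp only
    rw [norm_mul, Real.norm_eq_abs, Real.norm_eq_abs]
    have hD : |fderiv ℝ χ x (u x)| ≤ δ₁ * ‖u x‖ := by
      rw [← Real.norm_eq_abs]
      exact (ContinuousLinearMap.le_opNorm _ _).trans (mul_le_mul_of_nonneg_right (hDχ x) (norm_nonneg _))
    calc |P x - c| * |fderiv ℝ χ x (u x)| ≤ |P x - c| * (δ₁ * ‖u x‖) :=
          mul_le_mul_of_nonneg_left hD (abs_nonneg _)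
      _ = δ₁ * (|P x - c| * ‖u x‖) := by ring
      _ ≤ δ₁ * ((P x - c) ^ 2 + ‖u x‖ ^ 2) := by
          refine mul_le_mul_of_nonneg_left ?_ hδ₁
          nlinarith [sq_nonneg (|P x - c| - ‖u x‖), sq_abs (P x - c), abs_nonneg (P x - c), norm_nonneg (u x)]
  -- (iv) `|∫ (Dχ·V)|u|²| ≤ δ₁ M ∫|u|²`
  have b4 : |∫ x, fderiv ℝ χ x (V x) * ‖u x‖ ^ 2| ≤ δ₁ * M * e2 := by
    rw [← Real.norm_eq_abs, he2, ← integral_const_mul]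
    refine (norm_integral_le_integral_norm _).trans (integral_mono_of_nonneg
      (Eventually.of_forall fun x => norm_nonneg _) (hu2.const_mul _) (Eventually.of_forall fun x => ?_))
    dsimp only
    rw [norm_mul, Real.norm_eq_abs, Real.norm_eq_abs, abs_of_nonneg (sq_nonneg ‖u x‖)]
    refine mul_le_mul_of_nonneg_right ?_ (sq_nonneg _)
    rw [← Real.norm_eq_abs]
    exact (ContinuousLinearMap.le_opNorm _ _).trans (mul_le_mul (hDχ x) (hVM x) (norm_nonneg _) hδ₁)
  -- (v) `|∫ (Dχ·u)⟪V,u⟫| ≤ δ₁ M ∫|u|²`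
  have b5 : |∫ x, fderiv ℝ χ x (u x) * ⟪V x, u x⟫| ≤ δ₁ * M * e2 := by
    rw [← Real.norm_eq_abs, he2, ← integral_const_mul]
    refine (norm_integral_le_integral_norm _).trans (integral_mono_of_nonneg
      (Eventually.of_forall fun x => norm_nonneg _) (hu2.const_mul _) (Eventually.of_forall fun x => ?_))
    dsimp only
    rw [norm_mul, Real.norm_eq_abs, Real.norm_eq_abs]
    have hD : |fderiv ℝ χ x (u x)| ≤ δ₁ * ‖u x‖ := by
      rw [← Real.norm_eq_abs]
      exact (ContinuousLinearMap.le_opNorm _ _).trans (mul_le_mul_of_nonneg_right (hDχ x) (norm_nonneg _))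
    have hI : |⟪V x, u x⟫| ≤ M * ‖u x‖ :=
      (abs_real_inner_le_norm _ _).trans (mul_le_mul_of_nonneg_right (hVM x) (norm_nonneg _))
    calc |fderiv ℝ χ x (u x)| * |⟪V x, u x⟫| ≤ (δ₁ * ‖u x‖) * (M * ‖u x‖) :=
          mul_le_mul hD hI (abs_nonneg _) (by positivity)
      _ = δ₁ * M * ‖u x‖ ^ 2 := by ring
  -- (vi) the stretching term against the dissipation (Young)
  have b6 : |∫ x, χ x * ⟪V x, convect u u x⟫| ≤
      2⁻¹ * (∫ x, χ x * frobeniusNormSq (fderiv ℝ u x)) + 2⁻¹ * M ^ 2 * ∫ x, χ x * ‖u x‖ ^ 2 := by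
    have iF : Integrable (fun x => χ x * frobeniusNormSq (fderiv ℝ u x)) volume :=
      cs_χ (continuous_frobeniusNormSq_fderiv hu1 one_ne_zero)
    have iN : Integrable (fun x => χ x * ‖u x‖ ^ 2) volume := cs_χ (huc.norm.pow 2)
    have iF' : Integrable (fun x => 2⁻¹ * (χ x * frobeniusNormSq (fderiv ℝ u x))) volume := iF.const_mul _
    have iN' : Integrable (fun x => 2⁻¹ * M ^ 2 * (χ x * ‖u x‖ ^ 2)) volume := iN.const_mul _
    rw [← Real.norm_eq_abs, ← integral_const_mul, ← integral_const_mul, ← integral_add iF' iN']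
    refine (norm_integral_le_integral_norm _).trans (integral_mono_of_nonneg
      (Eventually.of_forall fun x => norm_nonneg _) (iF'.add iN')
      (Eventually.of_forall fun x => ?_))
    dsimp only
    rw [norm_mul, Real.norm_eq_abs, Real.norm_eq_abs, abs_of_nonneg (hχ0 x)]
    have h := abs_inner_convect_le hM (hVM x) ((hu1.differentiable one_ne_zero) x)
    calc χ x * |⟪V x, convect u u x⟫| ≤ χ x * (2⁻¹ * frobeniusNormSq (fderiv ℝ u x) + 2⁻¹ * M ^ 2 * ‖u x‖ ^ 2) :=
          mul_le_mul_of_nonneg_left h (hχ0 x)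
      _ = 2⁻¹ * (χ x * frobeniusNormSq (fderiv ℝ u x)) + 2⁻¹ * M ^ 2 * (χ x * ‖u x‖ ^ 2) := by ring
  -- ### assembly
  rw [hF, hPress] at h0
  have hG0 : 0 ≤ ∫ x, χ x * frobeniusNormSq (fderiv ℝ u x) :=
    integral_nonneg fun x => mul_nonneg (hχ0 x) (frobeniusNormSq_nonneg _)
  have a1 := (abs_le.1 b1).2
  have a2 := (abs_le.1 b2).2
  have a3 := (abs_le.1 b3).2
  have a4 := (abs_le.1 b4).2
  have a5 := (abs_le.1 b5).2
  have a6 := (abs_le.1 b6).2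
  rw [h0]
  nlinarith [a1, a2, a3, a4, a5, a6, hG0]

end Slice


/-! ### §3 Elementary tools: Grönwall's bound, slopes -/

section Tools

/-- `gronwallBound δ K ε x ≤ (δ + ε x) e^{Kx}` for nonnegative data (`(e^{Kx} − 1)/K ≤ x e^{Kx}`). [folklore] -/
theorem gronwallBound_le {δ K ε x : ℝ} (hδ : 0 ≤ δ) (hK : 0 ≤ K) (hε : 0 ≤ ε) (hx : 0 ≤ x) :
    gronwallBound δ K ε x ≤ (δ + ε * x) * Real.exp (K * x) := by
  have _ := hδ
  rcases eq_or_lt_of_le hK with hK0 | hKpos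
  · rw [← hK0, gronwallBound_K0, zero_mul, Real.exp_zero, mul_one]
  · rw [gronwallBound_of_K_ne_0 hKpos.ne']
    have hKx : 0 ≤ K * x := mul_nonneg hK hx
    -- `e^{Kx} - 1 ≤ Kx e^{Kx}`
    have key : Real.exp (K * x) - 1 ≤ K * x * Real.exp (K * x) := by
      have h1 : 1 - K * x ≤ Real.exp (-(K * x)) := by
        have := Real.add_one_le_exp (-(K * x)); linarith
      have h2 : Real.exp (K * x) * Real.exp (-(K * x)) = 1 := by
        rw [← Real.exp_add, add_neg_cancel, Real.exp_zero]
      nlinarith [Real.exp_pos (K * x), Real.exp_pos (-(K * x))]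
    have h3 : ε / K * (Real.exp (K * x) - 1) ≤ ε * x * Real.exp (K * x) := by
      rw [div_mul_eq_mul_div, div_le_iff₀ hKpos]
      nlinarith [key, hε]
    nlinarith [h3]

end Tools

/-! ### §4 The energy inequality in time -/

section Time

variable {t₁ t₂ : ℝ} {v V : ℝ → E → E} {πv πV : ℝ → E → ℝ}

omit [MeasurableSpace E] [BorelSpace E] in
/-- Joint continuity of the Frobenius norm of the spatial derivative of a jointly smooth field on
an open time set. [folklore] -/
theorem continuousOn_frobeniusNormSq_fderiv_slice {S : Set ℝ} {w : ℝ → E → E}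
    (hw : IsSmoothSpaceTimeOn S w) (hS : IsOpen S) :
    ContinuousOn (fun z : ℝ × E => frobeniusNormSq (fderiv ℝ (w z.1) z.2)) (S ×ˢ univ) := by
  have h := hw.continuousOn_fderiv_slice hS.uniqueDiffOn
  unfold frobeniusNormSq
  refine continuousOn_finsetSum _ fun i _ => ((h.clm_apply continuousOn_const).norm).pow 2

/-- **The energy inequality for the difference of two classical solutions** (Albritton 2018, proof
of Prop. 4.5, (4.33): "`U ∈ L^∞_t L²_x ∩ L²_t Ḣ¹_x` up to the blow-up time"; Leray's energy method).
Let `(v, π_v)`, `(V, π_V)` solve the unforced unit-viscosity Navier–Stokes system classically on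
`(t₁, t₂)`, with `|v| ≤ M_v`, `|V| ≤ M` there; suppose the slices of `W = v − V` are square
integrable, `∫ |W(s)|² ≤ Λ`, and the pressure difference is square integrable up to a constant,
`∫ |π_v(s) − π_V(s) − c_s|² ≤ Pb`, for all `s ∈ (t₁, t₂)`. Then for `t₀ ≤ t` in `(t₁, t₂)`:
`∫ |W(t)|² ≤ (∫ |W(t₀)|²) e^{M²(t − t₀)}` and
`∫_{t₀}^{t} ∫ |∇W|²_F ≤ (∫ |W(t₀)|²)(1 + M²(t − t₀)) e^{M²(t − t₀)}` — bounds depending on the bound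
`M` of `V` only (not on `M_v`, `Λ`, `Pb`). Proof: module docstring, §§2–4. [cite: Albritton2018, Prop. 4.5 proof, (4.32)–(4.33); Leray1934 §17] -/
theorem energy_inequality (hv : IsClassicalNSSolutionOn (Ioo t₁ t₂) 1 0 v πv)
    (hV : IsClassicalNSSolutionOn (Ioo t₁ t₂) 1 0 V πV) {Mv M : ℝ} (hMv : 0 ≤ Mv) (hM : 0 ≤ M)
    (hvM : ∀ s ∈ Ioo t₁ t₂, ∀ x, ‖v s x‖ ≤ Mv) (hVM : ∀ s ∈ Ioo t₁ t₂, ∀ x, ‖V s x‖ ≤ M)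
    {Λ : ℝ} (hΛ : ∀ s ∈ Ioo t₁ t₂, Integrable (fun x => ‖v s x - V s x‖ ^ 2) volume ∧
      ∫ x, ‖v s x - V s x‖ ^ 2 ≤ Λ)
    {Pb : ℝ} (hPb : ∀ s ∈ Ioo t₁ t₂, ∃ c : ℝ, Integrable (fun x => (πv s x - πV s x - c) ^ 2) volume ∧
      ∫ x, (πv s x - πV s x - c) ^ 2 ≤ Pb)
    {t₀ t : ℝ} (ht₀ : t₀ ∈ Ioo t₁ t₂) (ht : t ∈ Ioo t₁ t₂) (ht₀t : t₀ ≤ t) :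
    (∫ x, ‖v t x - V t x‖ ^ 2) ≤ (∫ x, ‖v t₀ x - V t₀ x‖ ^ 2) * Real.exp (M ^ 2 * (t - t₀)) ∧
    ∫⁻ z in Ioo t₀ t ×ˢ (univ : Set E),
        ENNReal.ofReal (frobeniusNormSq (fderiv ℝ (fun y => v z.1 y - V z.1 y) z.2)) ≤
      ENNReal.ofReal ((∫ x, ‖v t₀ x - V t₀ x‖ ^ 2) * (1 + M ^ 2 * (t - t₀)) *
        Real.exp (M ^ 2 * (t - t₀))) := by
  set S : Set ℝ := Ioo t₁ t₂ with hSdef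
  have hS : IsOpen S := isOpen_Ioo
  have hIcc : Icc t₀ t ⊆ S := fun s hs => ⟨ht₀.1.trans_le hs.1, hs.2.trans_lt ht.2⟩
  -- ### the remainder and its equation
  set W : ℝ → E → E := fun s y => v s y - V s y with hWdef
  set P : ℝ → E → ℝ := fun s y => πv s y - πV s y with hPdef
  have hWsm : IsSmoothSpaceTimeOn S W := hv.smooth_velocity.sub hV.smooth_velocity
  have hPsm : IsSmoothSpaceTimeOn S P := hv.smooth_pressure.sub hV.smooth_pressure
  set dtW : ℝ → E → E := timeDerivWithin S W with hdtWdef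
  have hdtWsm : IsSmoothSpaceTimeOn S dtW := hWsm.timeDerivWithin hS.uniqueDiffOn
  have hΛ0 : 0 ≤ Λ := le_trans (integral_nonneg fun x => by positivity) (hΛ t₀ ht₀).2
  have hPb0 : 0 ≤ Pb := by
    obtain ⟨c, -, hc⟩ := hPb t₀ ht₀
    exact le_trans (integral_nonneg fun x => by positivity) hc
  set MW : ℝ := Mv + M with hMW
  have hWbd : ∀ s ∈ S, ∀ x, ‖W s x‖ ≤ MW := fun s hs x =>
    (norm_sub_le _ _).trans (add_le_add (hvM s hs x) (hVM s hs x))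
  -- ### the cut-offs and their constants
  obtain ⟨C₁, hC₁0, hC₁⟩ := exists_norm_fderiv_cutoff_le (E := E)
  obtain ⟨C₂, hC₂0, hC₂⟩ := exists_abs_laplacian_cutoff_le (E := E)
  set R : ℕ → ℝ := fun n => (n : ℝ) + 1 with hRdef
  have hRpos : ∀ n, 0 < R n := fun n => by simp only [hRdef]; positivity
  set χ : ℕ → E → ℝ := fun n => cutoff (R n) with hχdef
  have hχs : ∀ n, ContDiff ℝ ∞ (χ n) := fun n => contDiff_cutoff (R n)
  have hχ2 : ∀ n, ContDiff ℝ 2 (χ n) := fun n => contDiff_cutoff (R n)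
  have hχc : ∀ n, HasCompactSupport (χ n) := fun n => hasCompactSupport_cutoff (hRpos n)
  have hχ0 : ∀ n x, 0 ≤ χ n x := fun n x => cutoff_nonneg _ _
  have hχ1 : ∀ n x, χ n x ≤ 1 := fun n x => cutoff_le_one _ _
  set δ₁ : ℕ → ℝ := fun n => C₁ / R n with hδ₁
  set δ₂ : ℕ → ℝ := fun n => C₂ / R n ^ 2 with hδ₂
  have hδ₁0 : ∀ n, 0 ≤ δ₁ n := fun n => by simp only [hδ₁]; positivity
  have hδ₂0 : ∀ n, 0 ≤ δ₂ n := fun n => by simp only [hδ₂]; positivity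
  set ε : ℕ → ℝ := fun n => (δ₁ n * (MW + 3 * M) + δ₂ n) * Λ + 2 * δ₁ n * (Pb + Λ) with hεdef
  have hε0 : ∀ n, 0 ≤ ε n := fun n => by simp only [hεdef]; positivity
  -- `ε n → 0`
  have hεlim : Tendsto ε atTop (𝓝 0) := by
    have hR : Tendsto R atTop atTop := tendsto_atTop_add_const_right _ 1 tendsto_natCast_atTop_atTop
    have h1 : Tendsto δ₁ atTop (𝓝 0) := by
      simp only [hδ₁]
      exact tendsto_const_nhds.div_atTop hR
    have h2 : Tendsto δ₂ atTop (𝓝 0) := by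
      simp only [hδ₂]
      exact tendsto_const_nhds.div_atTop (tendsto_pow_atTop two_ne_zero |>.comp hR)
    have h := ((h1.mul_const (MW + 3 * M)).add h2).mul_const Λ |>.add ((h1.const_mul 2).mul_const (Pb + Λ))
    simpa [hεdef] using h
  -- ### the cut-off energies
  set En : ℕ → ℝ → ℝ := fun n s => ∫ x, χ n x * ‖W s x‖ ^ 2 with hEn
  set In : ℕ → ℝ → ℝ := fun n s => ∫ x, χ n x * ⟪dtW s x, W s x⟫ with hIn
  set Gn : ℕ → ℝ → ℝ := fun n s => ∫ x, χ n x * frobeniusNormSq (fderiv ℝ (W s) x) with hGn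
  have hEn0 : ∀ n s, 0 ≤ En n s := fun n s => integral_nonneg fun x => mul_nonneg (hχ0 n x) (sq_nonneg _)
  have hGn0 : ∀ n s, 0 ≤ Gn n s := fun n s =>
    integral_nonneg fun x => mul_nonneg (hχ0 n x) (frobeniusNormSq_nonneg _)
  -- (a) the time derivative of `En n`
  have hderiv : ∀ n, ∀ s ∈ S, HasDerivAt (En n) (2 * In n s) s := by
    intro n s hs
    have hΦ : IsSmoothSpaceTimeOn S fun s x => χ n x * ‖W s x‖ ^ 2 := by
      have h := (isSmoothSpaceTimeOn_const_time (hχs n) S).mul (hWsm.inner hWsm)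
      refine h.congr (fun z _ => ?_)
      simp only [uncurry, real_inner_self_eq_norm_sq]
    have hsupp : ∀ s ∈ S, ∀ x ∉ tsupport (χ n), χ n x * ‖W s x‖ ^ 2 = 0 := fun s _ x hx => by
      rw [image_eq_zero_of_notMem_tsupport hx, zero_mul]
    have hD := FluidPDE.hasDerivAt_integral_of_support_subset (μ := volume) hS hΦ (hχc n) hsupp hs
    have heq : ∫ x, deriv (fun s => χ n x * ‖W s x‖ ^ 2) s = 2 * In n s := by
      rw [hIn, ← integral_const_mul]
      refine integral_congr_ae (Eventually.of_forall fun x => ?_)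
      have hl : HasDerivAt (fun s => W s x) (deriv (fun s => W s x) s) s := hWsm.hasDerivAt_timeLine hS hs x
      have hdt : deriv (fun s => W s x) s = dtW s x := by
        rw [hdtWdef, FluidPDE.timeDerivWithin_eq_deriv_of_mem_nhds (hS.mem_nhds hs) W x]
      have hin := (hl.inner ℝ hl).const_mul (χ n x)
      have e : (fun s => χ n x * ‖W s x‖ ^ 2) = fun s => χ n x * ⟪W s x, W s x⟫ := by
        funext s; rw [real_inner_self_eq_norm_sq]
      show deriv (fun s => χ n x * ‖W s x‖ ^ 2) s = 2 * (χ n x * ⟪dtW s x, W s x⟫)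
      rw [e, hin.deriv, hdt, real_inner_comm (W s x)]
      ring
    rwa [heq] at hD
  -- (b) the slice inequality: `2 In + Gn ≤ M² En + ε n`
  have hslice : ∀ n, ∀ s ∈ S, 2 * In n s + Gn n s ≤ M ^ 2 * En n s + ε n := by
    intro n s hs
    obtain ⟨c, hci, hcb⟩ := hPb s hs
    have hu : ContDiff ℝ 2 (W s) := contDiff_infty.1 (hWsm.contDiff_slice hs) 2
    have hPc : ContDiff ℝ 1 (P s) := contDiff_infty.1 (hPsm.contDiff_slice hs) 1
    have hdtc : Continuous (dtW s) := (hdtWsm.contDiff_slice hs).continuous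
    have hV1 : ContDiff ℝ 1 (V s) := contDiff_infty.1 (hV.contDiff_velocity hs) 1
    have hdivW : VectorCalculus.IsDivFree (W s) := fun x => by
      show VectorCalculus.divergence (fun y => v s y - V s y) x = 0
      rw [divergence_sub_apply (((hv.contDiff_velocity hs).differentiable (by simp)) x)
        (((hV.contDiff_velocity hs).differentiable (by simp)) x), hv.divFree s hs x, hV.divFree s hs x, sub_zero]
    have hmom : ∀ x, dtW s x + convect (W s) (W s) x = (1 : ℝ) • (Δ (W s)) x - gradient (P s) x +
        (-(convect (V s) (W s) x + convect (W s) (V s) x)) := fun x => remainder_momentum hv hV hs x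
    have h := slice_inequality hu hPc hdtc hV1 hdivW (hV.divFree s hs) hM (hVM s hs) (hWbd s hs) hmom
      (hΛ s hs).1 hci (hχ2 n) (hχc n) (hχ0 n) (hδ₁0 n) (fun x => hC₁ (R n) (hRpos n) x)
      (fun x => hC₂ (R n) (hRpos n) x) (δ₂ := δ₂ n)
    have hb1 : (δ₁ n * (MW + 3 * M) + δ₂ n) * (∫ x, ‖W s x‖ ^ 2) ≤ (δ₁ n * (MW + 3 * M) + δ₂ n) * Λ :=
      mul_le_mul_of_nonneg_left (hΛ s hs).2 (by positivity)
    have hb2 : 2 * δ₁ n * ((∫ x, (P s x - c) ^ 2) + ∫ x, ‖W s x‖ ^ 2) ≤ 2 * δ₁ n * (Pb + Λ) :=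
      mul_le_mul_of_nonneg_left (add_le_add hcb (hΛ s hs).2) (by positivity)
    simp only [hεdef]
    linarith [h, hb1, hb2]
  -- (c) Grönwall for `En n` on `[t₀, t]`
  set T : ℝ := t - t₀ with hT
  have hT0 : 0 ≤ T := by rw [hT]; linarith
  have hcontE : ∀ n, ContinuousOn (En n) (Icc t₀ t) := fun n s hs =>
    (hderiv n s (hIcc hs)).continuousAt.continuousWithinAt
  have hgron : ∀ n, ∀ s ∈ Icc t₀ t, En n s ≤ (En n t₀ + ε n * T) * Real.exp (M ^ 2 * T) := by
    intro n s hs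
    have hG := le_gronwallBound_of_liminf_deriv_right_le (f := En n)
      (f' := fun s => M ^ 2 * En n s + ε n) (δ := En n t₀) (K := M ^ 2) (ε := ε n) (a := t₀) (b := t)
      (hcontE n) ?_ le_rfl (fun x _ => le_rfl) s hs
    · refine hG.trans ((gronwallBound_le (hEn0 n t₀) (sq_nonneg M) (hε0 n) (by linarith [hs.1])).trans ?_)
      have h1 : En n t₀ + ε n * (s - t₀) ≤ En n t₀ + ε n * T :=
        add_le_add le_rfl (mul_le_mul_of_nonneg_left (by rw [hT]; linarith [hs.2]) (hε0 n))
      have h2 : Real.exp (M ^ 2 * (s - t₀)) ≤ Real.exp (M ^ 2 * T) :=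
        Real.exp_le_exp.2 (mul_le_mul_of_nonneg_left (by rw [hT]; linarith [hs.2]) (sq_nonneg M))
      exact mul_le_mul h1 h2 (Real.exp_pos _).le (by nlinarith [hEn0 n t₀, hε0 n])
    · intro x hx r hr
      have hxS : x ∈ S := hIcc ⟨hx.1, hx.2.le⟩
      have hD := hderiv n x hxS
      have hle : 2 * In n x ≤ M ^ 2 * En n x + ε n := by linarith [hslice n x hxS, hGn0 n x]
      have hlt : 2 * In n x < r := hle.trans_lt hr
      have hfr := hD.hasDerivWithinAt.liminf_right_slope_le hlt
      refine hfr.mono fun z hz => ?_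
      rw [slope_def_field, div_eq_inv_mul] at hz
      exact hz
  -- (d) the dissipation for fixed `n`: `∫_{t₀}^{t} Gn n ≤ Dₙ`
  have hcontI : ∀ n, ContinuousOn (In n) S := by
    intro n
    refine FluidPDE.continuousOn_integral_of_support_subset (μ := volume) (K := tsupport (χ n)) (hχc n) ?_ ?_
    · have h1 : ContinuousOn (fun z : ℝ × E => χ n z.2) (S ×ˢ univ) :=
        ((hχs n).continuous.comp continuous_snd).continuousOn
      exact h1.mul ((hdtWsm.continuousOn).inner hWsm.continuousOn)
    · intro s _ x hx
      show χ n x * ⟪dtW s x, W s x⟫ = 0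
      rw [image_eq_zero_of_notMem_tsupport hx, zero_mul]
  have hcontG : ∀ n, ContinuousOn (Gn n) S := by
    intro n
    refine FluidPDE.continuousOn_integral_of_support_subset (μ := volume) (K := tsupport (χ n)) (hχc n) ?_ ?_
    · have h1 : ContinuousOn (fun z : ℝ × E => χ n z.2) (S ×ˢ univ) :=
        ((hχs n).continuous.comp continuous_snd).continuousOn
      exact h1.mul (continuousOn_frobeniusNormSq_fderiv_slice hWsm hS)
    · intro s _ x hx
      show χ n x * frobeniusNormSq (fderiv ℝ (W s) x) = 0
      rw [image_eq_zero_of_notMem_tsupport hx, zero_mul]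
  set D : ℕ → ℝ := fun n => M ^ 2 * T * ((En n t₀ + ε n * T) * Real.exp (M ^ 2 * T)) + ε n * T + En n t₀ with hDdef
  have hdiss : ∀ n, ∫ s in t₀..t, Gn n s ≤ D n := by
    intro n
    have hFTC : ∫ s in t₀..t, 2 * In n s = En n t - En n t₀ := by
      refine intervalIntegral.integral_eq_sub_of_hasDerivAt (fun s hs => hderiv n s (hIcc ?_)) ?_
      · rwa [uIcc_of_le ht₀t] at hs
      · exact ((hcontI n).mono hIcc |>.const_smul (2:ℝ) |>.congr (fun s _ => by simp [smul_eq_mul])).intervalIntegrable_of_Icc ht₀t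
    have hIG : IntervalIntegrable (Gn n) volume t₀ t := ((hcontG n).mono hIcc).intervalIntegrable_of_Icc ht₀t
    have hIE : IntervalIntegrable (fun s => M ^ 2 * En n s + ε n) volume t₀ t :=
      ((((hcontE n).const_smul (M ^ 2)).congr (fun s _ => by simp [smul_eq_mul])).add continuousOn_const)
        |>.intervalIntegrable_of_Icc ht₀t
    have hII : IntervalIntegrable (fun s => 2 * In n s) volume t₀ t :=
      ((hcontI n).mono hIcc |>.const_smul (2:ℝ) |>.congr (fun s _ => by simp [smul_eq_mul])).intervalIntegrable_of_Icc ht₀t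
    -- `Gn ≤ M² En + ε n − 2 In` pointwise on `[t₀, t]`
    have hmono : ∫ s in t₀..t, Gn n s ≤ ∫ s in t₀..t, ((M ^ 2 * En n s + ε n) - 2 * In n s) := by
      refine intervalIntegral.integral_mono_on ht₀t hIG (hIE.sub hII) fun s hs => ?_
      linarith [hslice n s (hIcc hs)]
    rw [intervalIntegral.integral_sub hIE hII, hFTC, intervalIntegral.integral_add
      (((((hcontE n).const_smul (M ^ 2)).congr (fun s _ => by simp [smul_eq_mul]))).intervalIntegrable_of_Icc ht₀t)
      (continuousOn_const.intervalIntegrable_of_Icc ht₀t), intervalIntegral.integral_const] at hmono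
    -- bound `∫ M² En ≤ M² T sup En`
    have hsup : ∫ s in t₀..t, M ^ 2 * En n s ≤ M ^ 2 * T * ((En n t₀ + ε n * T) * Real.exp (M ^ 2 * T)) := by
      have h1 : ∫ s in t₀..t, M ^ 2 * En n s ≤ ∫ _ in t₀..t, M ^ 2 * ((En n t₀ + ε n * T) * Real.exp (M ^ 2 * T)) := by
        refine intervalIntegral.integral_mono_on ht₀t
          ((((hcontE n).const_smul (M ^ 2)).congr (fun s _ => by simp [smul_eq_mul])).intervalIntegrable_of_Icc ht₀t)
          (continuousOn_const.intervalIntegrable_of_Icc ht₀t) fun s hs => ?_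
        exact mul_le_mul_of_nonneg_left (hgron n s hs) (sq_nonneg M)
      rw [intervalIntegral.integral_const, smul_eq_mul] at h1
      calc ∫ s in t₀..t, M ^ 2 * En n s ≤ (t - t₀) * (M ^ 2 * ((En n t₀ + ε n * T) * Real.exp (M ^ 2 * T))) := h1
        _ = M ^ 2 * T * ((En n t₀ + ε n * T) * Real.exp (M ^ 2 * T)) := by rw [hT]; ring
    have hEt : 0 ≤ En n t := hEn0 n t
    simp only [smul_eq_mul] at hmono
    simp only [hDdef]
    rw [hT] at hsup ⊢
    linarith [hmono, hsup, hEt]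
  -- ### the limit `n → ∞`
  -- (e) `En n s → ∫ |W s|²` for `s ∈ S` (dominated convergence)
  have hElim : ∀ s ∈ S, Tendsto (fun n => En n s) atTop (𝓝 (∫ x, ‖W s x‖ ^ 2)) := by
    intro s hs
    refine tendsto_integral_of_dominated_convergence (fun x => ‖W s x‖ ^ 2) (fun n => ?_) (hΛ s hs).1
      (fun n => Eventually.of_forall fun x => ?_) (Eventually.of_forall fun x => ?_)
    · exact (((hχs n).continuous.mul ((hWsm.contDiff_slice hs).continuous.norm.pow 2))).aestronglyMeasurable
    · rw [Real.norm_eq_abs, abs_of_nonneg (mul_nonneg (hχ0 n x) (sq_nonneg _))]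
      calc χ n x * ‖W s x‖ ^ 2 ≤ 1 * ‖W s x‖ ^ 2 := mul_le_mul_of_nonneg_right (hχ1 n x) (sq_nonneg _)
        _ = ‖W s x‖ ^ 2 := one_mul _
    · have h := (tendsto_cutoff_natCast_add_one x).mul_const (‖W s x‖ ^ 2)
      rw [one_mul] at h
      exact h
  set e₀ : ℝ := ∫ x, ‖W t₀ x‖ ^ 2 with he₀
  have he₀0 : 0 ≤ e₀ := integral_nonneg fun x => by positivity
  have hboundlim : Tendsto (fun n => (En n t₀ + ε n * T) * Real.exp (M ^ 2 * T)) atTop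
      (𝓝 ((e₀ + 0 * T) * Real.exp (M ^ 2 * T))) :=
    (((hElim t₀ ht₀).add (hεlim.mul_const T)).mul_const _)
  rw [zero_mul, add_zero] at hboundlim
  refine ⟨?_, ?_⟩
  · -- ### (i) the `L²` bound
    exact le_of_tendsto_of_tendsto' (hElim t ht) hboundlim fun n => hgron n t ⟨ht₀t, le_rfl⟩
  · -- ### (ii) the dissipation bound: Fatou in `n`
    have hDlim : Tendsto D atTop (𝓝 (M ^ 2 * T * (e₀ * Real.exp (M ^ 2 * T)) + 0 * T + e₀)) := by
      simp only [hDdef]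
      exact ((hboundlim.const_mul (M ^ 2 * T)).add (hεlim.mul_const T)).add (hElim t₀ ht₀)
    rw [zero_mul, add_zero] at hDlim
    -- the limit is at most the stated bound
    have hDle : M ^ 2 * T * (e₀ * Real.exp (M ^ 2 * T)) + e₀ ≤ e₀ * (1 + M ^ 2 * T) * Real.exp (M ^ 2 * T) := by
      have h1 : e₀ ≤ e₀ * Real.exp (M ^ 2 * T) := by
        have : 1 ≤ Real.exp (M ^ 2 * T) := Real.one_le_exp (by positivity)
        nlinarith
      nlinarith [h1]
    -- the space–time integrand and its cut-off versions
    set Φ : ℝ × E → ℝ≥0∞ := fun z => ENNReal.ofReal (frobeniusNormSq (fderiv ℝ (W z.1) z.2)) with hΦdef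
    set Φn : ℕ → ℝ × E → ℝ≥0∞ := fun n z =>
      ENNReal.ofReal (χ n z.2 * frobeniusNormSq (fderiv ℝ (W z.1) z.2)) with hΦndef
    set μ : Measure (ℝ × E) := volume.restrict (Ioo t₀ t ×ˢ (univ : Set E)) with hμdef
    have hslab : Ioo t₀ t ×ˢ (univ : Set E) ⊆ S ×ˢ univ := prod_mono (fun s hs => hIcc ⟨hs.1.le, hs.2.le⟩) subset_rfl
    have hmeasS : MeasurableSet (Ioo t₀ t ×ˢ (univ : Set E)) := measurableSet_Ioo.prod MeasurableSet.univ
    have hΦn_meas : ∀ n, AEMeasurable (Φn n) μ := by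
      intro n
      have hc : ContinuousOn (fun z : ℝ × E => χ n z.2 * frobeniusNormSq (fderiv ℝ (W z.1) z.2))
          (Ioo t₀ t ×ˢ (univ : Set E)) :=
        ((((hχs n).continuous.comp continuous_snd).continuousOn).mul
          (continuousOn_frobeniusNormSq_fderiv_slice hWsm hS)).mono hslab
      exact ENNReal.measurable_ofReal.comp_aemeasurable (hc.aemeasurable hmeasS)
    -- pointwise: `Φ = liminf Φn` (indeed the limit, `χ n → 1`)
    have hptw : ∀ z, Tendsto (fun n => Φn n z) atTop (𝓝 (Φ z)) := by
      intro z
      have h := (tendsto_cutoff_natCast_add_one z.2).mul_const (frobeniusNormSq (fderiv ℝ (W z.1) z.2))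
      rw [one_mul] at h
      exact ENNReal.tendsto_ofReal h
    have hΦeq : ∀ z, Φ z = liminf (fun n => Φn n z) atTop := fun z => (hptw z).liminf_eq.symm
    -- each cut-off space–time integral is `ofReal (∫_{t₀}^{t} Gn n)`
    have hprod : ∀ n, ∫⁻ z, Φn n z ∂μ ≤ ENNReal.ofReal (D n) := by
      intro n
      have hμ' : μ = (volume.restrict (Ioo t₀ t)).prod volume := by
        rw [hμdef, show (volume : Measure (ℝ × E)) = (volume : Measure ℝ).prod volume from rfl,
          ← Measure.prod_restrict, Measure.restrict_univ]
      have hmeas' : AEMeasurable (Φn n) ((volume.restrict (Ioo t₀ t)).prod volume) := by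
        rw [← hμ']; exact hΦn_meas n
      rw [hμ', lintegral_prod _ hmeas']
      -- inner integrals
      have hinner : ∀ s ∈ Ioo t₀ t, ∫⁻ x, Φn n (s, x) = ENNReal.ofReal (Gn n s) := by
        intro s hs
        have hsS : s ∈ S := hIcc ⟨hs.1.le, hs.2.le⟩
        have hcont : Continuous fun x => χ n x * frobeniusNormSq (fderiv ℝ (W s) x) :=
          (hχs n).continuous.mul (continuous_frobeniusNormSq_fderiv
            (contDiff_infty.1 (hWsm.contDiff_slice hsS) 1) one_ne_zero)
        have hint : Integrable (fun x => χ n x * frobeniusNormSq (fderiv ℝ (W s) x)) volume :=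
          hcont.integrable_of_hasCompactSupport ((hχc n).mul_right)
        rw [hGn, ofReal_integral_eq_lintegral_ofReal hint
          (Eventually.of_forall fun x => mul_nonneg (hχ0 n x) (frobeniusNormSq_nonneg _))]
      rw [setLIntegral_congr_fun measurableSet_Ioo hinner]
      -- the time integral
      have hGi : IntegrableOn (Gn n) (Ioo t₀ t) volume :=
        (((hcontG n).mono hIcc).integrableOn_compact isCompact_Icc).mono_set Ioo_subset_Icc_self
      rw [← ofReal_integral_eq_lintegral_ofReal hGi (Eventually.of_forall fun s => hGn0 n s)]
      refine ENNReal.ofReal_le_ofReal ?_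
      rw [← integral_Ioc_eq_integral_Ioo, ← intervalIntegral.integral_of_le ht₀t]
      exact hdiss n
    calc ∫⁻ z in Ioo t₀ t ×ˢ (univ : Set E), Φ z
        = ∫⁻ z, liminf (fun n => Φn n z) atTop ∂μ := lintegral_congr fun z => hΦeq z
      _ ≤ liminf (fun n => ∫⁻ z, Φn n z ∂μ) atTop := lintegral_liminf_le' hΦn_meas
      _ ≤ liminf (fun n => ENNReal.ofReal (D n)) atTop := liminf_le_liminf (Eventually.of_forall hprod)
      _ = ENNReal.ofReal (M ^ 2 * T * (e₀ * Real.exp (M ^ 2 * T)) + e₀) :=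
          ((ENNReal.tendsto_ofReal hDlim).liminf_eq)
      _ ≤ ENNReal.ofReal (e₀ * (1 + M ^ 2 * T) * Real.exp (M ^ 2 * T)) := ENNReal.ofReal_le_ofReal hDle

end Time

end PerturbedEnergyInequality

end Literature.Analysis.FluidPDE

end
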